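import Literature.AlgebraicGeometry.Motives.BettiCycleClass
import Literature.AlgebraicGeometry.Motives.VarietiesDimensionProofs
import HarnessLib

/-!
# Discharged fact: a smooth projective closed subvariety of dimension `d` has `dim = d`

`Literature.AlgebraicGeometry.Motives.BettiCycleClass` records as a named fact
(`Literature.ClosedSubvariety.dim_eq_of_isSmoothProjective : Prop`, cited there to Hartshorne I.1.8A
and II Ex. 3.20) that a closed subvariety `Z ⊆ X` of a `k`-scheme which, as a `k`-scheme
`Z ↪ X → Spec k`, is smooth projective of dimension `d` (`Literature.IsSmoothProjective d`) has
`Z.dim = d`, where `Z.dim : ℕ∞` is the height of the generic point of `Z` in the specialisation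
order of `X` (`a ≤ b ↔ b ⤳ a`), i.e. the Krull dimension of the closed irreducible subset `Z`.
This file proves it (`Literature.AlgebraicGeometry.Motives.ClosedSubvariety.dim_eq_of_isSmoothProjective_holds`), so that the
hypothesis `hd : Z.dim = d` of `Literature.AlgebraicGeometry.Motives.BettiCycleData.intCycleClass_closedSubvariety` can be fed
`Z.dim_eq_of_isSmoothProjective_holds hZ`.

## Proof

Three steps, the last being the dimension theory already in the tree:

1. `Literature.AlgebraicGeometry.Motives.Scheme.height_base_eq_of_isClosedEmbedding`: a morphism of schemes whose underlying map
   is a closed embedding (e.g. a closed immersion) preserves the heights of points in the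
   specialisation orders, `height (f y) = height y`: `f` is strictly monotone (an embedding
   reflects specialisations, Mathlib `Topology.IsInducing.specializes_iff`) and strict
   specialisations of `f y` lift along the closed map `f` (`Literature.AlgebraicGeometry.Motives.exists_lt_base_eq_of_isClosedMap`),
   so Mathlib's `Order.height_eq_of_strictMono` applies. (Hartshorne I.1, proof of Prop. 1.10:
   chains of closed irreducible subsets of a subspace have closures forming chains in the ambient
   space; for a *closed* subspace nothing is lost.)
2. `Literature.AlgebraicGeometry.Motives.Scheme.height_genericPoint`: for an irreducible scheme `Y`, the height of the generic
   point is `topologicalKrullDim Y`: the generic point is the top of the specialisation order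
   (Mathlib `genericPoint_specializes`), and closed irreducible subsets of the sober space `Y`
   correspond to points (Mathlib `irreducibleSetEquivPoints`). Hence
   `(Z.dim : WithBot ℕ∞) = topologicalKrullDim Z.carrier` (`coe_dim_eq_topologicalKrullDim`).
3. `Z.carrier → Spec k` is smooth of relative dimension `d` and `Z.carrier` is non-empty
   (integral), so `topologicalKrullDim Z.carrier = d` by
   `Literature.AlgebraicGeometry.Motives.topologicalKrullDim_eq_of_smoothOfRelativeDimension`
   (`Literature.AlgebraicGeometry.Motives.VarietiesDimensionProofs`: Görtz–Wedhorn I, Lemma 6.26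
   with Lemma 5.7 (4); in Hartshorne's definition of "smooth of relative dimension `n`",
   III.10 p. 268, condition (2) with `Y = Spec k`, this is built in, and by II Ex. 3.20 (b) /
   I Thm. 1.8A (a) it is the transcendence degree of the function field). Projectivity and geometric
   irreducibility are not used (`dim_eq_of_smoothOfRelativeDimension`).

## References

* R. Hartshorne, *Algebraic Geometry*, GTM 52, Springer (1977), doi:10.1007/978-1-4757-3849-0:
  I Thm. 1.8A (`dim B = tr.deg_k K(B)`, `height 𝔭 + dim B/𝔭 = dim B`), I Prop. 1.10 (proof:
  chains of closed irreducible subsets of a subspace versus chains of their closures), II Ex. 2.9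
  (generic points of irreducible closed subsets of a scheme), II.3 p. 86 (dimension and
  codimension for schemes) and II Ex. 3.20 (dimension theory of integral schemes of finite type
  over a field), III.10 p. 268 (definition of a morphism smooth of relative dimension `n`).
  [Hartshorne1977]
* U. Görtz, T. Wedhorn, *Algebraic Geometry I: Schemes*, 2nd ed. (2020), Lemma 5.7 ((1): a closed
  irreducible subset of a subspace `Y ⊆ X` is the trace of its closure; (4):
  `dim X = sup_x dim 𝒪_{X,x}`) and Lemma 6.26. [GortzWedhorn2020]
-/

universe u

open CategoryTheory AlgebraicGeometry Order Topology

namespace Literature.AlgebraicGeometry.Motives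

/-! ### Heights of points under closed embeddings; height of the generic point -/

section Scheme

variable {X Y : Scheme.{u}}

/-- **Closed embeddings preserve heights of points.** If the underlying map of `f : Y ⟶ X` is a
closed embedding (e.g. `f` a closed immersion), then for every `y : Y` the height of `f y` in the
specialisation order of `X` equals the height of `y` in that of `Y`, i.e.
`dim closure {f y} = dim closure {y}`: `f` is strictly monotone because an embedding reflects
specialisations, and every strict specialisation of `f y` lifts along the closed map `f`
(`Literature.AlgebraicGeometry.Motives.exists_lt_base_eq_of_isClosedMap`), so `Order.height_eq_of_strictMono` applies
(Hartshorne I.1, proof of Prop. 1.10, and Görtz–Wedhorn I, proof of Lemma 5.7 (1): closed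
irreducible subsets of a subspace are the traces of their closures; for a *closed* subspace the
two posets below a point agree). [cite: Hartshorne1977, I Prop. 1.10 (proof)] [cite: GortzWedhorn2020, Lemma 5.7 (1) (proof)] -/
theorem Scheme.height_base_eq_of_isClosedEmbedding (f : Y ⟶ X) (hf : IsClosedEmbedding f.base)
    (y : Y) : height (f.base y) = height y := by
  refine (height_eq_of_strictMono f.base (fun a b hab ↦ ?_)
    (fun a b h ↦ exists_lt_base_eq_of_isClosedMap f hf.isClosedMap h) y).symm
  refine lt_iff_le_not_ge.mpr ⟨?_, fun h ↦ hab.not_ge ?_⟩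
  · exact Scheme.le_iff_specializes.mpr ((Scheme.le_iff_specializes.mp hab.le).map f.continuous)
  · exact Scheme.le_iff_specializes.mpr
      (hf.isInducing.specializes_iff.mp (Scheme.le_iff_specializes.mp h))

/-- For a closed immersion `f : Y ⟶ X`, `height (f y) = height y` for every point `y` of `Y`
(`Scheme.height_base_eq_of_isClosedEmbedding`; Hartshorne I.1, proof of Prop. 1.10; Görtz–Wedhorn I,
Lemma 5.7 (1)). [cite: Hartshorne1977, I Prop. 1.10 (proof)] [cite: GortzWedhorn2020, Lemma 5.7 (1) (proof)] -/
theorem Scheme.height_base_eq_of_isClosedImmersion (f : Y ⟶ X) [IsClosedImmersion f] (y : Y) :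
    height (f.base y) = height y :=
  Scheme.height_base_eq_of_isClosedEmbedding f f.isClosedEmbedding y

/-- **The height of the generic point is the dimension.** For an irreducible scheme `Y`, the
height of its generic point in the specialisation order is the topological Krull dimension of
`Y`: closed irreducible subsets of the sober space `Y` correspond order-isomorphically to points
(Mathlib `irreducibleSetEquivPoints`), and the generic point is the top element
(`genericPoint_specializes`), whose height is the Krull dimension of the order (Hartshorne II
Ex. 2.9: irreducible closed subsets of a scheme have unique generic points; II.3 p. 86: the
dimension of a scheme is that of its space, I.1: chains of closed irreducible subsets). [cite: Hartshorne1977, II Ex. 2.9 and II.3 p. 86 (definition of dimension)] -/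
theorem Scheme.height_genericPoint (Y : Scheme.{u}) [IrreducibleSpace Y] :
    (height (genericPoint Y) : WithBot ℕ∞) = topologicalKrullDim Y := by
  have hk : topologicalKrullDim Y = krullDim Y :=
    krullDim_eq_of_orderIso (irreducibleSetEquivPoints (α := Y))
  rw [hk]
  refine le_antisymm (height_le_krullDim _) ?_
  rw [krullDim_eq_iSup_height]
  exact iSup_le fun y ↦ WithBot.coe_le_coe.mpr
    (height_mono (Scheme.le_iff_specializes.mpr (genericPoint_specializes y)))

end Scheme

/-! ### The dimension of a closed subvariety -/

namespace ClosedSubvariety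

section carrier

variable {X : Scheme.{u}} (Z : ClosedSubvariety X)

/-- The dimension of a closed subvariety `Z ⊆ X` (height of its generic point in `X`) is the
height of the generic point of the integral scheme `Z` in its own specialisation order: the
closed immersion `Z.ι` preserves heights (`Scheme.height_base_eq_of_isClosedImmersion`). [folklore] -/
theorem dim_eq_height_genericPoint : Z.dim = height (_root_.genericPoint Z.carrier) :=
  Scheme.height_base_eq_of_isClosedImmersion Z.ι _

/-- The dimension of a closed subvariety `Z ⊆ X` is the topological Krull dimension of the
underlying integral scheme of `Z` (Hartshorne II.3 p. 86 and II Ex. 3.20; Fulton, *Intersection Theory*,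
§1.2, `dim V`). [folklore] -/
theorem coe_dim_eq_topologicalKrullDim : (Z.dim : WithBot ℕ∞) = topologicalKrullDim Z.carrier := by
  rw [dim_eq_height_genericPoint, Scheme.height_genericPoint]

end carrier

variable {k : Type u} [Field k] {X : SchemeOver k} (Z : ClosedSubvariety X.left)

/-- The structure morphism of `Z.toSchemeOver` is `Z.ι ≫ (X → Spec k)` (by definition of
`Over.mk`; Hartshorne II.3). [folklore] -/
@[simp]
lemma toSchemeOver_hom : Z.toSchemeOver.hom = Z.ι ≫ X.hom := rfl

/-- The underlying scheme of `Z.toSchemeOver` is `Z.carrier` (by definition of `Over.mk`). [folklore] -/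
@[simp]
lemma toSchemeOver_left : Z.toSchemeOver.left = Z.carrier := rfl

/-- A closed subvariety `Z ⊆ X` of a `k`-scheme such that `Z → Spec k` is smooth of relative
dimension `d` (Mathlib `SmoothOfRelativeDimension`: locally standard smooth of relative
dimension `d`) has dimension `d`: by `coe_dim_eq_topologicalKrullDim` and the dimension of
non-empty smooth schemes over a field (`Literature.AlgebraicGeometry.Motives.topologicalKrullDim_eq_of_smoothOfRelativeDimension`;
Görtz–Wedhorn I, Lemma 6.26 with Lemma 5.7 (4); Hartshorne III.10, p. 268, and II Ex. 3.20).
Neither projectivity nor geometric irreducibility is needed. [cite: GortzWedhorn2020, Lemma 6.26 and Lemma 5.7 (4)] -/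
theorem dim_eq_of_smoothOfRelativeDimension {d : ℕ}
    [SmoothOfRelativeDimension d (Z.ι ≫ X.hom)] : Z.dim = d := by
  have h := Z.coe_dim_eq_topologicalKrullDim
  rw [topologicalKrullDim_eq_of_smoothOfRelativeDimension (Z.ι ≫ X.hom) d] at h
  exact_mod_cast h

/-- **Discharge of the named fact `Literature.AlgebraicGeometry.Motives.ClosedSubvariety.dim_eq_of_isSmoothProjective`.**
A closed subvariety `Z ⊆ X` of a `k`-scheme which is smooth projective of dimension `d` over `k`
has `Z.dim = d`, i.e. its generic point has height `d` in the specialisation order of `X`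
(Hartshorne I Thm. 1.8A and II Ex. 3.20 for the dimension theory of varieties; III.10, p. 268,
for the relative dimension of a smooth morphism): the smoothness field of `IsSmoothProjective`
feeds `dim_eq_of_smoothOfRelativeDimension`. [cite: Hartshorne1977, I Thm. 1.8A, II Ex. 3.20 and III.10 (definition p. 268)] [cite: GortzWedhorn2020, Lemma 6.26 and Lemma 5.7 (4)] -/
theorem dim_eq_of_isSmoothProjective_holds : Z.dim_eq_of_isSmoothProjective := by
  intro d hZ
  haveI : SmoothOfRelativeDimension d (Z.ι ≫ X.hom) := hZ.smoothOfRelativeDimension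
  exact Z.dim_eq_of_smoothOfRelativeDimension

end ClosedSubvariety

end Literature.AlgebraicGeometry.Motives
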